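/-
# CoverCountFine — the fine-room corollary: behind the v2 fine door, a class cover on the N side uses ≥ 10 DISTINCT N cells

`Summits/HodgeConjecture/HodgeConjecture/Cruxes/BlochSeedDiscOne/CoverCountFine.lean` — plan-lens-HodgeAV-anomaly **g16** (crux workfile under
`stmt-HodgeConjecture-18881`, NOT a proposal). Composes `CoverCount.classA_ten_cells` (room-free volume law, this seat) with sheaf8-1 g6's
`FineDoorRing2.charged_N_fine_ring3` (the fine shell-3 N-list: a hub-free supported N cell is `u⁴ ∕ Auuu ∕ Buuu`), which discharges the displayed
room hypothesis «every hub-free N-support cell has at most one off-axis letter» (`offCount_le_one_of_fine`).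

RESULTS. `fine_ten_cells`: `OnAlphabet 14`, `RingLe 3`, `Disj`, `RuleD`, `RuleDPFine`, clause 1 `A1e`, and BRANCH A′ of class `k`
(`0 < 2Σ − Re(i^k μ)`) ⇒ `10 ≤ #meetN 14 D k` — at least ten distinct N-support cells meet the class-`k` boxes (director R19.688 (iii), N side).
COARSE ROOM (axis-only alphabet): `axis_eleven_N_cells` (branch A′ ⇒ ≥ 11 distinct N cells), `axis_eleven_P_cells` (branch B′ ⇒ ≥ 11 distinct P cells).

HC ∕ HC_AV ∕ HC_CM ∕ H2 ∕ `stmt-HodgeConjecture-18881` ∕ `FloorFree 6 199 8` are NOT proved here or anywhere; `DepthBoundA4.Nonex 14 199 8` is REFUTED as typed.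
-/
import Summits.HodgeConjecture.HodgeConjecture.Cruxes.BlochSeedDiscOne.CoverCount
import Summits.HodgeConjecture.HodgeConjecture.Cruxes.BlochSeedDiscOne.FineDoorRing2

set_option linter.dupNamespace false
set_option linter.style.longLine false
set_option linter.unusedVariables false

namespace Summit.HodgeConjecture.HodgeConjecture.Cruxes.BlochSeedDiscOne.CoverCountFine

open Summit.HodgeConjecture.HodgeConjecture.Cruxes.BlochSeedDiscOne.DepthBoundA4
open Summit.HodgeConjecture.HodgeConjecture.Cruxes.BlochSeedDiscOne.BoxIdentity
open Summit.HodgeConjecture.HodgeConjecture.Cruxes.BlochSeedDiscOne.CoverCount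
open Summit.HodgeConjecture.HodgeConjecture.Cruxes.BlochSeedDiscOne.LeggedFloor (RuleD Disj)
open Summit.HodgeConjecture.HodgeConjecture.Cruxes.BlochSeedDiscOne.DeepLayerLaws (RingLe)
open Summit.HodgeConjecture.HodgeConjecture.Cruxes.BlochSeedDiscOne.RingTwoMassLaw (mem_supp_of_memN)
open Summit.HodgeConjecture.HodgeConjecture.Cruxes.BlochSeedDiscOne.FineDoorRing2 (RuleDPFine charged_N_fine_ring3)

/-- Behind the fine door a hub-free supported N cell of shell 3 has at most ONE off-axis letter (it is `u⁴`, `Auuu` or `Buuu`). -/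
theorem offCount_le_one_of_fine {D : Design} (hD : D.OnAlphabet 14) (hR : RingLe 3 D) (hdisj : Disj D) (hrule : RuleD D)
    (hfine : RuleDPFine D) {y : Cell} (hy : y ∈ D.suppN) (hnh : ∀ f : Fin 4, ¬((y f).x = 0 ∧ (y f).y = 0)) :
    offCount y ≤ 1 := by
  have hch : ∀ f : Fin 4, (y f).colevel ≠ 0 := by
    intro f h0
    unfold Letter.colevel at h0
    have hx := abs_nonneg (y f).x
    have hy' := abs_nonneg (y f).y
    have h1 : |(y f).x| = 0 := by omega
    have h2 : |(y f).y| = 0 := by omega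
    exact hnh f ⟨abs_eq_zero.mp h1, abs_eq_zero.mp h2⟩
  obtain ⟨nodeep, nomid2⟩ := charged_N_fine_ring3 hD hR hdisj hrule hfine hy hch
  have hle3 : ∀ f : Fin 4, (y f).colevel ≤ 3 := fun f => hR y (mem_supp_of_memN D hy) f
  have off2 : ∀ f : Fin 4, offB (y f) = true → (y f).colevel = 2 := by
    intro f hf
    simp only [offB, decide_eq_true_eq] at hf
    have h1 : 0 < |(y f).x| := abs_pos.mpr hf.1
    have h2 : 0 < |(y f).y| := abs_pos.mpr hf.2
    have h3 := hle3 f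
    have h4 := nodeep f
    unfold Letter.colevel at h3 h4 ⊢
    omega
  unfold offCount nOff
  rw [Finset.card_le_one]
  intro f hf g hg
  simp only [Finset.mem_filter, Finset.mem_univ, true_and] at hf hg
  by_contra hfg
  exact nomid2 f g hfg (off2 f hf) (off2 g hg)

/-- **TEN DISTINCT N CELLS BEHIND THE FINE DOOR** (director R19.688 (iii), N side, kernel): in BRANCH A′ of class `k` at least ten distinct
N-support cells meet the class-`k` boxes. -/
theorem fine_ten_cells {D : Design} (hD : D.OnAlphabet 14) (hR : RingLe 3 D) (hdisj : Disj D) (hrule : RuleD D) (hfine : RuleDPFine D)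
    (hA : A1e D) (k : Fin 4) (hpos : 0 < 2 * Sigma 14 D - (ipow k * D.mu).re) : 10 ≤ (meetN 14 D k).card :=
  classA_ten_cells 14 D hD hA k hpos fun c hc hnh => offCount_le_one_of_fine hD hR hdisj hrule hfine hc hnh

/-- The same in the `T±` reading of SHELL3-FLAYER §5: if `Ψ_k(D) > 0` for the class-`k` functional (an N cover of class `k`), ten distinct N cells. -/
theorem fine_ten_cells_of_Psi_pos {D : Design} (hD : D.OnAlphabet 14) (hR : RingLe 3 D) (hdisj : Disj D) (hrule : RuleD D)
    (hfine : RuleDPFine D) (hA : A1e D) (x : Fin 4 → Fin 4) (hx : 0 < Psi 14 x D) : 10 ≤ (meetN 14 D (wt x)).card := by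
  refine fine_ten_cells hD hR hdisj hrule hfine hA (wt x) ?_
  have hb := box_identity 14 D hA x
  omega

/-! ### Coarse room (axis-only alphabet `{H, u, A, C}`): caps are `6`, so ELEVEN distinct cells on the covering side -/

/-- An axis-only cell has no off-axis letter. -/
theorem offCount_eq_zero_of_axis (c : Cell) (hax : ∀ f : Fin 4, (c f).x * (c f).y = 0) : offCount c = 0 := by
  unfold offCount nOff
  rw [Finset.card_eq_zero, Finset.filter_eq_empty_iff]
  intro f _ hf
  simp only [offB, decide_eq_true_eq] at hf
  exact (mul_ne_zero hf.1 hf.2) (hax f)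

/-- **COARSE ROOM, N side:** axis-only N support + BRANCH A′ of class `k` ⇒ at least `11` distinct N-support cells meet class `k` (`64 ≤ 6·#`). -/
theorem axis_eleven_N_cells (hgt : ℤ) (D : Design) (hO : D.OnAlphabet hgt) (hA : A1e D) (k : Fin 4)
    (hpos : 0 < 2 * Sigma hgt D - (ipow k * D.mu).re) (hax : ∀ c ∈ D.suppN, ∀ f : Fin 4, (c f).x * (c f).y = 0) :
    11 ≤ (meetN hgt D k).card :=
  classA_eleven_cells hgt D hO hA k hpos fun c hc _ => offCount_eq_zero_of_axis c (hax c hc)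

/-- **COARSE ROOM, P side:** axis-only P support + BRANCH B′ ⇒ at least `11` distinct P-support cells meet class `k + 2`. -/
theorem axis_eleven_P_cells (hgt : ℤ) (D : Design) (hO : D.OnAlphabet hgt) (hA : A1e D) (k : Fin 4)
    (hk : 16 ≤ -(ipow k * D.mu).re) (hnonpos : 2 * Sigma hgt D - (ipow k * D.mu).re ≤ 0)
    (hax : ∀ c ∈ D.suppP, ∀ f : Fin 4, (c f).x * (c f).y = 0) :
    11 ≤ (meetP hgt D (k + 2)).card := by
  have hvol := classB_cover_volume hgt D hO hA k hk hnonpos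
  have hle : ∑ c ∈ meetP hgt D (k + 2), (met hgt c (k + 2)).card ≤ ∑ c ∈ meetP hgt D (k + 2), 6 := by
    apply Finset.sum_le_sum
    intro c hc
    simp only [meetP, Finset.mem_filter, List.mem_toFinset] at hc
    have hcO : ∀ f : Fin 4, (c f).OnAlphabet hgt := fun f => hO c (List.mem_append_right _ hc.1) f
    have hnh := hubfree_of_met_nonempty hgt c (k + 2) hcO hc.2
    have h1 := met_card_le hgt c (k + 2) hcO hnh
    have h2 : offCount c = 0 := offCount_eq_zero_of_axis c (hax c hc.1)
    have h3 : cap (offCount c) ≤ 6 := by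
      rw [h2]; decide
    omega
  rw [Finset.sum_const, smul_eq_mul] at hle
  omega

end Summit.HodgeConjecture.HodgeConjecture.Cruxes.BlochSeedDiscOne.CoverCountFine
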